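import Summits.QuantumFields.YangMills.Theorems.OneCertifiedCubeFiniteSizeCriterionRecursion
import Summits.QuantumFields.YangMills.Theorems.IR.TypFormatChainRule
import HarnessLib

/-!
# The Dobrushin–Shlosman block recursion WITH RARE BAD CELLS — one step (typical-class currency)

Helper module for item `stmt-QuantumFields-19354` (crux `IR`, route `BalabanLadder`; lane B; `--supports`, closes nothing).

The Typ twin of `FiniteSizeCriterion.recursion_step` (item 8895's engine, range-one specification on the edges of `ℤᵈ`
read through a cell map).  In the typical-class format of crux `IR` (`OnsetFormatsUc.TypShellCondUKPc`) the finite-size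
condition holds ONLY for exteriors good (`∈ Typ c`) on the non-resampled cells of the window-with-shell (hFS), and a
resampled cell is good only with kernel-probability `≥ 1 − δ₂` once its off-volume neighbours are good (hRare = clause
(ii)).  `recursion_step_typical`: IF moreover the single-cell influence at agreement radius `j(2n+1)` and goodness radius
`j(2n+1)+1` is `≤ δ` (hT), THEN at agreement radius `(j+1)(2n+1)` and goodness radius `(j+1)(2n+1)+1` it is
`≤ ε·M·(δ + δ₂) + 2(1+ε)·M·δ₂`, `M = (4n+3)ᵈ − (4n+1)ᵈ`.  Proof = the tree's step (localise to the cube; the localised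
observable oscillates by `≤ ε` — now only on configurations GOOD on the `≤ M` resampled shell cells — rescale; chain
rule `multiCell_influence_typical`) plus an exceptional event (some resampled shell cell bad) of mass `≤ M·δ₂` under both
kernels, on which the localised observable is within `1 + ε` of its rescaled proxy.  Iteration:
`Theorems/IR/TypFormatRecursion.lean`.

HONEST FRAMING: an abstract lemma about specifications; nothing about Yang–Mills mixing, no gap, not Clay.  No `sorry`.

## References
* R. L. Dobrushin, S. B. Shlosman, *Constructive criterion for the uniqueness of Gibbs field* (1985), §2.
* L. Bertini, E. N. M. Cirillo, E. Olivieri, Commun. Math. Phys. 261 (2006) (graded expansions with sparse bad blocks).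
-/

noncomputable section

open MeasureTheory
open Literature.Probability.LatticeModels
open Literature.MathematicalPhysics.QuantumLattice

namespace Summit.QuantumFields.YangMills.Theorems.FiniteSizeCriterion

variable {d : ℕ} {S : Type*} [MeasurableSpace S]

/-- Triangle inequality in the form used for cell distances. -/
theorem abs_sub_le_add_of_abs_sub_le {a b c p q : ℤ} (h1 : |a - b| ≤ p) (h2 : |b - c| ≤ q) : |a - c| ≤ p + q :=
  (abs_sub_le a b c).trans (add_le_add h1 h2)

/-- **One step of the Dobrushin–Shlosman block recursion with rare bad cells.** See the module docstring.  Radii are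
measured in cells of the cell map `cell`, in the `ℓ^∞` distance; `Good c` is a measurable event read off the cell `c`. -/
theorem recursion_step_typical {γ : Specification (ZdEdge d) S} (hγ : IsSpecification γ)
    (hloc : ∀ (Λ : Finset (ZdEdge d)) (f : (ZdEdge d → S) → ℝ) (T : Finset (ZdEdge d)),
      Measurable f → DependsOn f ↑T →
        DependsOn (fun η => ∫ σ, f σ ∂(γ Λ η)) ↑(T ∪ (plaquettesTouching Λ).biUnion plaquetteEdges))
    {cell : ZdEdge d → (Fin d → ℤ)}
    (hC1 : ∀ e e' : ZdEdge d, (∀ k, e'.1 k - 1 ≤ e.1 k ∧ e.1 k ≤ e'.1 k + 1) →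
      ∀ k, |cell e k - cell e' k| ≤ 1)
    (hfin : ∀ y : Fin d → ℤ, Set.Finite {v : ZdEdge d | cell v = y})
    {Good : (Fin d → ℤ) → Set (ZdEdge d → S)} (hGoodm : ∀ c, MeasurableSet (Good c))
    (hGooddep : ∀ c, DependsOn (fun σ : ZdEdge d → S => σ ∈ Good c) {v | cell v = c})
    {n : ℕ} {ε : ℝ} (hε : 0 ≤ ε)
    (hFS : ∀ (x : Fin d → ℤ) (Λ₀ : Finset (ZdEdge d)),
      (∀ v w, cell v = cell w → v ∈ Λ₀ → w ∈ Λ₀) →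
      (∀ v ∈ Λ₀, ∀ i, |cell v i - x i| ≤ 2 * n) → (∀ v, cell v = x → v ∈ Λ₀) →
      ∀ η η' : ZdEdge d → S, (∀ v, (∀ i, |cell v i - x i| ≤ 2 * n) → η v = η' v) →
      (∀ c : Fin d → ℤ, (∀ i, |c i - x i| ≤ 2 * n + 1) → ∀ v, cell v = c → v ∉ Λ₀ →
        η ∈ Good c ∧ η' ∈ Good c) →
      ∀ f : (ZdEdge d → S) → ℝ, DependsOn f {v | cell v = x} → Measurable f →
        (∀ σ, 0 ≤ f σ ∧ f σ ≤ 1) → |∫ σ, f σ ∂(γ Λ₀ η) - ∫ σ, f σ ∂(γ Λ₀ η')| ≤ ε)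
    {δ₂ : ℝ} (hδ₂ : 0 ≤ δ₂)
    (hRare : ∀ (Λ : Finset (ZdEdge d)), (∀ v w, cell v = cell w → v ∈ Λ → w ∈ Λ) →
      ∀ (y : Fin d → ℤ), (∃ v ∈ Λ, cell v = y) →
      ∀ ζ : ZdEdge d → S, (∀ c : Fin d → ℤ, (∀ i, |c i - y i| ≤ 1) → ∀ v, cell v = c → v ∉ Λ → ζ ∈ Good c) →
        (γ Λ ζ).real {σ | σ ∉ Good y} ≤ δ₂)
    {j : ℕ} {δ : ℝ} (hδ : 0 ≤ δ)
    (hT : ∀ (Λ : Finset (ZdEdge d)), (∀ v w, cell v = cell w → v ∈ Λ → w ∈ Λ) →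
      ∀ (x : Fin d → ℤ) (g : (ZdEdge d → S) → ℝ), Measurable g → (∀ σ, 0 ≤ g σ ∧ g σ ≤ 1) →
      DependsOn g {v | cell v = x} →
      ∀ ζ ζ' : ZdEdge d → S,
        (∀ v, v ∉ Λ → (∀ i, |cell v i - x i| ≤ j * (2 * n + 1)) → ζ v = ζ' v) →
        (∀ c : Fin d → ℤ, (∀ i, |c i - x i| ≤ j * (2 * n + 1) + 1) → ∀ v, cell v = c → v ∉ Λ →
          ζ ∈ Good c ∧ ζ' ∈ Good c) →
        |∫ σ, g σ ∂(γ Λ ζ) - ∫ σ, g σ ∂(γ Λ ζ')| ≤ δ)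
    (Λ : Finset (ZdEdge d)) (hΛ : ∀ v w, cell v = cell w → v ∈ Λ → w ∈ Λ)
    (x : Fin d → ℤ) (g : (ZdEdge d → S) → ℝ) (hgm : Measurable g) (hg01 : ∀ σ, 0 ≤ g σ ∧ g σ ≤ 1)
    (hgdep : DependsOn g {v | cell v = x}) (ζ ζ' : ZdEdge d → S)
    (hagree : ∀ v, v ∉ Λ → (∀ i, |cell v i - x i| ≤ (j + 1) * (2 * n + 1)) → ζ v = ζ' v)
    (hgood : ∀ c : Fin d → ℤ, (∀ i, |c i - x i| ≤ (j + 1) * (2 * n + 1) + 1) → ∀ v, cell v = c → v ∉ Λ →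
      ζ ∈ Good c ∧ ζ' ∈ Good c) :
    |∫ σ, g σ ∂(γ Λ ζ) - ∫ σ, g σ ∂(γ Λ ζ')| ≤
      ε * (((2 * (2 * n + 1) + 1) ^ d - (2 * (2 * n) + 1) ^ d : ℕ) : ℝ) * (δ + δ₂) +
        2 * (1 + ε) * (((2 * (2 * n + 1) + 1) ^ d - (2 * (2 * n) + 1) ^ d : ℕ) : ℝ) * δ₂ := by
  classical
  set M : ℝ := (((2 * (2 * n + 1) + 1) ^ d - (2 * (2 * n) + 1) ^ d : ℕ) : ℝ) with hM
  have hM0 : 0 ≤ M := Nat.cast_nonneg _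
  have hRHS : 0 ≤ ε * M * (δ + δ₂) + 2 * (1 + ε) * M * δ₂ := by positivity
  set R : ℤ := 2 * n with hR
  have hR0 : (0 : ℤ) ≤ R := by rw [hR]; positivity
  have hR1 : R + 1 ≤ (j + 1 : ℤ) * (2 * n + 1) := by rw [hR]; nlinarith
  have hR2 : R + 2 ≤ (j + 1 : ℤ) * (2 * n + 1) + 1 := by linarith
  -- trivial case: the cell `x` does not meet `Λ`
  by_cases hx : ∃ v ∈ Λ, cell v = x
  swap
  · have hgc : DependsOn g ((↑Λ : Set (ZdEdge d))ᶜ) := fun σ σ' h =>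
      hgdep fun v (hv : cell v = x) => h v fun hvΛ => hx ⟨v, Finset.mem_coe.1 hvΛ, hv⟩
    rw [kernel_integral_eq_of_dependsOn_compl hγ Λ hgc ζ,
      kernel_integral_eq_of_dependsOn_compl hγ Λ hgc ζ']
    have hζ : g ζ = g ζ' := hgdep fun v (hv : cell v = x) =>
      hagree v (fun hvΛ => hx ⟨v, hvΛ, hv⟩) fun i => by
        rw [hv, sub_self, abs_zero]; positivity
    rw [hζ, sub_self, abs_zero]
    exact hRHS
  -- the localised volume `Λ₀ = Λ ∩ cube`
  obtain ⟨v₀, hv₀Λ, hv₀x⟩ := hx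
  set Λ₀ : Finset (ZdEdge d) := Λ.filter fun v => ∀ i, |cell v i - x i| ≤ R with hΛ₀
  have hΛ₀Λ : Λ₀ ⊆ Λ := Finset.filter_subset _ _
  have hΛ₀union : ∀ v w, cell v = cell w → v ∈ Λ₀ → w ∈ Λ₀ := fun v w hvw hv => by
    rw [hΛ₀, Finset.mem_filter] at hv ⊢
    exact ⟨hΛ v w hvw hv.1, fun i => hvw ▸ hv.2 i⟩
  have hΛ₀near : ∀ v ∈ Λ₀, ∀ i, |cell v i - x i| ≤ 2 * n := fun v hv =>
    (Finset.mem_filter.1 hv).2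
  have hxΛ₀ : ∀ v, cell v = x → v ∈ Λ₀ := fun v hv =>
    Finset.mem_filter.2 ⟨hΛ v₀ v (hv₀x.trans hv.symm) hv₀Λ, fun i => by
      rw [hv, sub_self, abs_zero]; exact hR0⟩
  have hnotΛ : ∀ v, v ∉ Λ₀ → (∀ i, |cell v i - x i| ≤ R) → v ∉ Λ := fun v hv hd hvΛ =>
    hv (Finset.mem_filter.2 ⟨hvΛ, hd⟩)
  -- all sites of a cell lie on the same side of `Λ`
  have hcellout : ∀ (c : Fin d → ℤ) (v : ZdEdge d), cell v = c → v ∉ Λ → ∀ u, cell u = c → u ∉ Λ :=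
    fun c v hvc hv u hu huΛ => hv (hΛ u v (hu.trans hvc.symm) huΛ)
  -- the localised observable `g₀ = γ_{Λ₀} g`
  set g₀ : (ZdEdge d → S) → ℝ := fun σ => ∫ τ, g τ ∂(γ Λ₀ σ) with hg₀
  have hg₀m : Measurable g₀ := DobrushinShlosman.measurable_windowAvg' hγ Λ₀ hgm
  have hg₀01 : ∀ σ, 0 ≤ g₀ σ ∧ g₀ σ ≤ 1 := fun σ => by
    haveI := hγ.isProbability Λ₀ σ
    exact integral_mem_unitInterval hgm hg01
  have hg1 : ∀ σ, |g σ| ≤ 1 := fun σ => by rw [abs_of_nonneg (hg01 σ).1]; exact (hg01 σ).2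
  have hcons : ∀ η, ∫ σ, g σ ∂(γ Λ η) = ∫ σ, g₀ σ ∂(γ Λ η) := fun η =>
    (kernel_integral_integral_eq_of_subset hγ hΛ₀Λ η hgm hg1).symm
  -- `g₀` depends only on the edges off `Λ₀` within cell distance `R + 1`
  have hgT : DependsOn g (↑(hfin x).toFinset : Set (ZdEdge d)) := fun σ σ' h =>
    hgdep fun v hv => h v (by rw [Set.Finite.coe_toFinset]; exact hv)
  have hg₀dep' := hloc Λ₀ g (hfin x).toFinset hgm hgT
  have hg₀dep : DependsOn g₀ {v | v ∉ Λ₀ ∧ ∀ i, |cell v i - x i| ≤ R + 1} := by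
    intro σ σ' h
    let σ'' : ZdEdge d → S := fun v => if v ∈ Λ₀ then σ v else σ' v
    have e1 : g₀ σ' = g₀ σ'' := by
      simp only [hg₀]
      rw [DobrushinShlosman.spec_apply_congr hγ Λ₀ (ω := σ') (η := σ'') fun v hv => by
        simp only [σ'', hv, if_false]]
    have e2 : g₀ σ'' = g₀ σ := by
      refine hg₀dep' fun v hv => ?_
      by_cases hvΛ₀ : v ∈ Λ₀
      · simp only [σ'', hvΛ₀, if_true]
      · simp only [σ'', hvΛ₀, if_false]
        refine (h v ⟨hvΛ₀, ?_⟩).symm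
        rcases Finset.mem_union.1 (Finset.mem_coe.1 hv) with hvT | hvC
        · have hvx : cell v = x := (hfin x).mem_toFinset.1 hvT
          intro i; rw [hvx, sub_self, abs_zero]; positivity
        · obtain ⟨e', he', hnear⟩ := exists_near_of_mem_collar hvC
          intro i
          rw [add_comm]; exact abs_sub_le_add_of_abs_sub_le (hC1 v e' hnear i) (hΛ₀near e' he' i)
    rw [← e2, ← e1]
  -- the resampled shell cells `Ysh` and the good event `T` (all of them good)
  set Ysh : Finset (Fin d → ℤ) := (Λ.image cell).filter fun y =>
    (∀ i, |y i - x i| ≤ R + 1) ∧ ¬ (∀ i, |y i - x i| ≤ R) with hYsh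
  have hYshΛ : ∀ y ∈ Ysh, ∃ v ∈ Λ, cell v = y := fun y hy => by
    obtain ⟨v, hv, hvy⟩ := Finset.mem_image.1 (Finset.mem_filter.1 hy).1
    exact ⟨v, hv, hvy⟩
  have hYshR : ∀ y ∈ Ysh, ∀ i, |y i - x i| ≤ R + 1 := fun y hy => (Finset.mem_filter.1 hy).2.1
  have hcard : (Ysh.card : ℝ) ≤ M := by
    have h : Ysh.card ≤ (2 * (2 * n + 1) + 1) ^ d - (2 * (2 * n) + 1) ^ d := by
      refine card_shell_le x (2 * n) Ysh fun y hy => ?_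
      have h := (Finset.mem_filter.1 hy).2
      simp only [hR] at h
      exact_mod_cast h
    rw [hM]; exact_mod_cast h
  set T : Set (ZdEdge d → S) := {σ | ∀ y ∈ Ysh, σ ∈ Good y} with hTdef
  have hTm : MeasurableSet T := by
    have : T = ⋂ y ∈ Ysh, Good y := by
      ext σ; simp only [hTdef, Set.mem_setOf_eq, Set.mem_iInter]
    rw [this]
    exact MeasurableSet.biInter (Finset.countable_toSet _) fun y _ => hGoodm y
  have hTc : Tᶜ = ⋃ y ∈ Ysh, {σ | σ ∉ Good y} := by
    ext σ
    simp only [hTdef, Set.mem_compl_iff, Set.mem_setOf_eq, not_forall, Set.mem_iUnion, exists_prop]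
  -- the exceptional mass under `γ_Λ(η)` for `η` good near `x`
  have hexc : ∀ η : ZdEdge d → S,
      (∀ c : Fin d → ℤ, (∀ i, |c i - x i| ≤ R + 2) → ∀ v, cell v = c → v ∉ Λ → η ∈ Good c) →
      (γ Λ η).real Tᶜ ≤ M * δ₂ := by
    intro η hη
    rw [hTc]
    calc (γ Λ η).real (⋃ y ∈ Ysh, {σ | σ ∉ Good y}) ≤ ∑ y ∈ Ysh, (γ Λ η).real {σ | σ ∉ Good y} :=
          measureReal_biUnion_finset_le _ _
      _ ≤ ∑ _y ∈ Ysh, δ₂ := Finset.sum_le_sum fun y hy =>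
          hRare Λ hΛ y (hYshΛ y hy) η fun c hc v hvc hv => hη c (fun i => by
            have h := abs_sub_le_add_of_abs_sub_le (hc i) (hYshR y hy i); linarith) v hvc hv
      _ = Ysh.card * δ₂ := by rw [Finset.sum_const, nsmul_eq_mul]
      _ ≤ M * δ₂ := mul_le_mul_of_nonneg_right hcard hδ₂
  have hgoodR2 : ∀ η : ZdEdge d → S, (η = ζ ∨ η = ζ') →
      ∀ c : Fin d → ℤ, (∀ i, |c i - x i| ≤ R + 2) → ∀ v, cell v = c → v ∉ Λ → η ∈ Good c := by
    rintro η hη c hc v hvc hv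
    have h := hgood c (fun i => (hc i).trans hR2) v hvc hv
    rcases hη with rfl | rfl
    · exact h.1
    · exact h.2
  -- oscillation `≤ ε` of `g₀` on GOOD configurations equal to `ζ` on the cube-with-shell edges off `Λ`
  set Rset : Set (ZdEdge d → S) :=
    {σ | ∀ v, v ∉ Λ → (∀ i, |cell v i - x i| ≤ R + 1) → σ v = ζ v} with hRset
  have hosc : ∀ σ σ' : ZdEdge d → S, σ ∈ Rset → σ' ∈ Rset → σ ∈ T → σ' ∈ T → |g₀ σ - g₀ σ'| ≤ ε := by
    intro σ σ' hσ hσ' hσT hσ'T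
    let τ : (ZdEdge d → S) → (ZdEdge d → S) := fun ω v => if v ∈ Λ₀ then ζ v else ω v
    have hτ : ∀ ω, g₀ ω = g₀ (τ ω) := fun ω => by
      simp only [hg₀]
      rw [DobrushinShlosman.spec_apply_congr hγ Λ₀ (ω := ω) (η := τ ω) fun v hv => by
        simp only [τ, hv, if_false]]
    have hτG : ∀ (ω : ZdEdge d → S) (c : Fin d → ℤ), (∀ v, cell v = c → v ∉ Λ₀) →
        (τ ω ∈ Good c) = (ω ∈ Good c) := fun ω c hc =>
      hGooddep c fun u (hu : cell u = c) => by simp only [τ, hc u hu, if_false]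
    rw [hτ σ, hτ σ']
    refine hFS x Λ₀ hΛ₀union hΛ₀near hxΛ₀ (τ σ) (τ σ') (fun v hd => ?_) ?_ g hgdep hgm hg01
    · by_cases hv : v ∈ Λ₀
      · simp only [τ, hv, if_true]
      · simp only [τ, hv, if_false]
        have hd' : ∀ i, |cell v i - x i| ≤ R + 1 := fun i => (hd i).trans (by linarith)
        rw [hσ v (hnotΛ v hv hd) hd', hσ' v (hnotΛ v hv hd) hd']
    · intro c hc v hvc hv
      -- every site of the cell `c` is off `Λ₀`
      have hcΛ₀ : ∀ u, cell u = c → u ∉ Λ₀ := fun u hu huΛ₀ => hv (hΛ₀union u v (hu.trans hvc.symm) huΛ₀)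
      rw [hτG σ c hcΛ₀, hτG σ' c hcΛ₀]
      by_cases hvΛ : v ∈ Λ
      · -- a resampled shell cell: goodness is membership in `T`
        have hcY : c ∈ Ysh := by
          refine Finset.mem_filter.2 ⟨Finset.mem_image.2 ⟨v, hvΛ, hvc⟩, ?_, fun hcR => hv ?_⟩
          · simpa [hR] using hc
          · exact Finset.mem_filter.2 ⟨hvΛ, fun i => hvc ▸ hcR i⟩
        exact ⟨hσT c hcY, hσ'T c hcY⟩
      · -- an exterior cell: both configurations equal `ζ` on it, and `ζ` is good there
        have hout := hcellout c v hvc hvΛ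
        have hcR : ∀ u, cell u = c → ∀ i, |cell u i - x i| ≤ R + 1 := fun u hu i => by
          rw [hu]; simpa [hR] using hc i
        have eσ : (σ ∈ Good c) = (ζ ∈ Good c) :=
          hGooddep c fun u (hu : cell u = c) => hσ u (hout u hu) (hcR u hu)
        have eσ' : (σ' ∈ Good c) = (ζ ∈ Good c) :=
          hGooddep c fun u (hu : cell u = c) => hσ' u (hout u hu) (hcR u hu)
        rw [eσ, eσ']
        have hζc := hgoodR2 ζ (Or.inl rfl) c (fun i => by
          have := hc i; simp only [hR] at this ⊢; linarith) v hvc hvΛ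
        exact ⟨hζc, hζc⟩
  -- the infimum `a` of `g₀` over the good configurations of `Rset`
  have hbdd : BddBelow (g₀ '' (Rset ∩ T)) := ⟨0, fun r ⟨σ, _, hr⟩ => hr ▸ (hg₀01 σ).1⟩
  set a : ℝ := sInf (g₀ '' (Rset ∩ T)) with ha
  have ha_le : ∀ σ, σ ∈ Rset → σ ∈ T → a ≤ g₀ σ := fun σ hσ hσT => csInf_le hbdd ⟨σ, ⟨hσ, hσT⟩, rfl⟩
  have hle_a : ∀ σ, σ ∈ Rset → σ ∈ T → g₀ σ ≤ a + ε := fun σ hσ hσT => by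
    have h : g₀ σ - ε ≤ a := le_csInf ⟨g₀ σ, σ, ⟨hσ, hσT⟩, rfl⟩ fun r ⟨σ', hσ', hr⟩ => by
      rw [← hr]
      have := abs_le.1 (hosc σ σ' hσ hσ'.1 hσT hσ'.2)
      linarith
    linarith
  have ha0 : 0 ≤ a := Real.sInf_nonneg fun r ⟨σ, _, hr⟩ => hr ▸ (hg₀01 σ).1
  have ha1 : a ≤ 1 := by
    by_cases hne : (Rset ∩ T).Nonempty
    · obtain ⟨σ, hσ, hσT⟩ := hne
      exact (ha_le σ hσ hσT).trans (hg₀01 σ).2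
    · rw [Set.not_nonempty_iff_eq_empty] at hne
      rw [ha, hne, Set.image_empty, Real.sInf_empty]
      exact zero_le_one
  -- the frozen, rescaled observable `H`
  let Φ : (ZdEdge d → S) → (ZdEdge d → S) := fun σ v => if cell v ∈ Ysh then σ v else ζ v
  have hΦm : Measurable Φ := by
    refine measurable_pi_iff.2 fun v => ?_
    by_cases hv : cell v ∈ Ysh
    · simp only [Φ, hv, if_true]; exact measurable_pi_apply v
    · simp only [Φ, hv, if_false]; exact measurable_const
  set H : (ZdEdge d → S) → ℝ := fun σ => min 1 (max 0 ((g₀ (Φ σ) - a) / ε)) with hH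
  have hHm : Measurable H :=
    measurable_const.min (measurable_const.max (((hg₀m.comp hΦm).sub_const a).div_const ε))
  have hH01 : ∀ σ, 0 ≤ H σ ∧ H σ ≤ 1 := fun σ =>
    ⟨le_min zero_le_one (le_max_left _ _), min_le_left _ _⟩
  have hHdep : DependsOn H {v | cell v ∈ Ysh} := by
    intro σ σ' h
    simp only [hH]
    have hΦ : Φ σ = Φ σ' := funext fun v => by
      by_cases hv : cell v ∈ Ysh
      · simp only [Φ, hv, if_true]; exact h v hv
      · simp only [Φ, hv, if_false]
    rw [hΦ]
  -- under `γ_Λ(· | η)`, `η = ζ` on the cube-with-shell edges off `Λ`: on `T`, `g₀ = a + ε H`; off `T`, within `1 + ε`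
  have hkey : ∀ η : ZdEdge d → S, (∀ v, v ∉ Λ → (∀ i, |cell v i - x i| ≤ R + 1) → η v = ζ v) →
      ∀ᵐ σ ∂(γ Λ η), |g₀ σ - (a + ε * H σ)| ≤ (1 + ε) * Tᶜ.indicator (fun _ => (1 : ℝ)) σ := by
    intro η hη
    filter_upwards [hγ.proper Λ η] with σ hσ
    by_cases hσT : σ ∈ T
    · have hσR : σ ∈ Rset := fun v hv hd => by rw [hσ v hv]; exact hη v hv hd
      have hΦR : Φ σ ∈ Rset := fun v hv hd => by
        by_cases hc : cell v ∈ Ysh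
        · simp only [Φ, hc, if_true]; exact hσR v hv hd
        · simp only [Φ, hc, if_false]
      have hΦT : Φ σ ∈ T := fun y hy => by
        have e : (Φ σ ∈ Good y) = (σ ∈ Good y) :=
          hGooddep y fun u (hu : cell u = y) => by simp only [Φ, hu, hy, if_true]
        rw [e]; exact hσT y hy
      have hΦσ : g₀ (Φ σ) = g₀ σ := by
        refine hg₀dep fun v hv => ?_
        obtain ⟨hv₀, hvd⟩ := hv
        by_cases hc : cell v ∈ Ysh
        · simp only [Φ, hc, if_true]
        · simp only [Φ, hc, if_false]
          by_cases hvΛ : v ∈ Λ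
          · exfalso
            refine hc (Finset.mem_filter.2 ⟨Finset.mem_image_of_mem _ hvΛ, hvd, fun hd => ?_⟩)
            exact hv₀ (Finset.mem_filter.2 ⟨hvΛ, hd⟩)
          · rw [hσ v hvΛ, hη v hvΛ hvd]
      have h1 := ha_le σ hσR hσT
      have h2 := hle_a σ hσR hσT
      have hind : Tᶜ.indicator (fun _ => (1 : ℝ)) σ = 0 :=
        Set.indicator_of_notMem (fun h => Set.notMem_of_mem_compl h hσT) _
      rw [hind, mul_zero]
      simp only [hH, hΦσ]
      rcases hε.eq_or_lt with hε0 | hεpos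
      · rw [← hε0, zero_mul, add_zero]
        rw [← hε0, add_zero] at h2
        rw [le_antisymm h2 h1, sub_self, abs_zero]
      · have ht0 : 0 ≤ (g₀ σ - a) / ε := div_nonneg (by linarith) hεpos.le
        have ht1 : (g₀ σ - a) / ε ≤ 1 := by rw [div_le_one hεpos]; linarith
        rw [max_eq_right ht0, min_eq_right ht1, mul_div_cancel₀ _ hεpos.ne']
        ring_nf
        rw [abs_zero]
    · have hind : Tᶜ.indicator (fun _ => (1 : ℝ)) σ = 1 := Set.indicator_of_mem (Set.mem_compl hσT) _
      rw [hind, mul_one]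
      have hg := hg₀01 σ
      have hHσ := hH01 σ
      have hεH : 0 ≤ ε * H σ ∧ ε * H σ ≤ ε := ⟨mul_nonneg hε hHσ.1, by nlinarith [hHσ.2]⟩
      rw [abs_le]; constructor <;> linarith [hg.1, hg.2, hεH.1, hεH.2]
  have hint : ∀ η : ZdEdge d → S, (∀ v, v ∉ Λ → (∀ i, |cell v i - x i| ≤ R + 1) → η v = ζ v) →
      (∀ c : Fin d → ℤ, (∀ i, |c i - x i| ≤ R + 2) → ∀ v, cell v = c → v ∉ Λ → η ∈ Good c) →
      |∫ σ, g₀ σ ∂(γ Λ η) - (a + ε * ∫ σ, H σ ∂(γ Λ η))| ≤ (1 + ε) * (M * δ₂) := by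
    intro η hη hηg
    haveI := hγ.isProbability Λ η
    have hHi : Integrable H (γ Λ η) := DobrushinMetric.integrable_of_abs_le' hHm (M := 1)
      fun σ => by rw [abs_of_nonneg (hH01 σ).1]; exact (hH01 σ).2
    have hg₀i : Integrable g₀ (γ Λ η) := DobrushinMetric.integrable_of_abs_le' hg₀m (M := 1)
      fun σ => by rw [abs_of_nonneg (hg₀01 σ).1]; exact (hg₀01 σ).2
    have hPi : Integrable (fun σ => a + ε * H σ) (γ Λ η) := (integrable_const a).add (hHi.const_mul ε)
    have hIi : Integrable (fun σ => (1 + ε) * Tᶜ.indicator (fun _ => (1 : ℝ)) σ) (γ Λ η) :=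
      ((integrable_const (1 : ℝ)).indicator hTm.compl).const_mul _
    have e1 : a + ε * ∫ σ, H σ ∂(γ Λ η) = ∫ σ, (a + ε * H σ) ∂(γ Λ η) := by
      rw [integral_add (integrable_const a) (hHi.const_mul ε), integral_const, integral_const_mul]
      simp
    rw [e1, ← integral_sub hg₀i hPi]
    calc |∫ σ, (g₀ σ - (a + ε * H σ)) ∂(γ Λ η)| ≤ ∫ σ, |g₀ σ - (a + ε * H σ)| ∂(γ Λ η) := by
          rw [← Real.norm_eq_abs]; exact norm_integral_le_integral_norm _
      _ ≤ ∫ σ, (1 + ε) * Tᶜ.indicator (fun _ => (1 : ℝ)) σ ∂(γ Λ η) :=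
          integral_mono_ae (hg₀i.sub hPi).abs hIi (hkey η hη)
      _ = (1 + ε) * (γ Λ η).real Tᶜ := by
          rw [integral_const_mul, integral_indicator_const _ hTm.compl]; simp
      _ ≤ (1 + ε) * (M * δ₂) := mul_le_mul_of_nonneg_left (hexc η hηg) (by linarith)
  -- the chain rule over the resampled shell cells, typical-class currency
  have hchain : |∫ σ, H σ ∂(γ Λ ζ) - ∫ σ, H σ ∂(γ Λ ζ')| ≤ Ysh.card * (δ + δ₂) := by
    refine multiCell_influence_typical (cell := cell)
      (near := fun y v => ∀ i, |cell v i - y i| ≤ j * (2 * n + 1))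
      (fun v i => by rw [sub_self, abs_zero]; positivity)
      (tnear := fun y c => ∀ i, |c i - y i| ≤ j * (2 * n + 1) + 1)
      (adj := fun y c => ∀ i, |c i - y i| ≤ 1)
      (fun y c h i => (h i).trans (by nlinarith)) hGoodm hGooddep hγ hδ₂ hT hRare Ysh Λ hΛ H hHm hH01 hHdep ζ ζ'
      (fun y hy v hv hd => hagree v hv fun i => ?_) (fun y hy c hc v hvc hv => hgood c (fun i => ?_) v hvc hv)
    · have h := abs_sub_le_add_of_abs_sub_le (hd i) (hYshR y hy i); rw [hR] at h; linarith
    · have h := abs_sub_le_add_of_abs_sub_le (hc i) (hYshR y hy i); rw [hR] at h; linarith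
  -- assemble
  have hζ' : ∀ v, v ∉ Λ → (∀ i, |cell v i - x i| ≤ R + 1) → ζ' v = ζ v := fun v hv hd =>
    (hagree v hv fun i => (hd i).trans hR1).symm
  have hIζ := hint ζ (fun _ _ _ => rfl) (hgoodR2 ζ (Or.inl rfl))
  have hIζ' := hint ζ' hζ' (hgoodR2 ζ' (Or.inr rfl))
  rw [hcons ζ, hcons ζ']
  -- abbreviations for the final estimate
  set Iζ := ∫ σ, g₀ σ ∂(γ Λ ζ) with hIζdef
  set Iζ' := ∫ σ, g₀ σ ∂(γ Λ ζ') with hIζ'def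
  set Hζ := ∫ σ, H σ ∂(γ Λ ζ) with hHζdef
  set Hζ' := ∫ σ, H σ ∂(γ Λ ζ') with hHζ'def
  have hsplit : |Iζ - Iζ'| ≤ ε * |Hζ - Hζ'| + 2 * ((1 + ε) * (M * δ₂)) := by
    have hmid : |(a + ε * Hζ) - (a + ε * Hζ')| = ε * |Hζ - Hζ'| := by
      rw [add_sub_add_left_eq_sub, ← mul_sub, abs_mul, abs_of_nonneg hε]
    have h3 : |(a + ε * Hζ') - Iζ'| ≤ (1 + ε) * (M * δ₂) := by rw [abs_sub_comm]; exact hIζ'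
    calc |Iζ - Iζ'| ≤ |Iζ - (a + ε * Hζ)| + |(a + ε * Hζ) - Iζ'| := abs_sub_le _ _ _
      _ ≤ |Iζ - (a + ε * Hζ)| + (|(a + ε * Hζ) - (a + ε * Hζ')| + |(a + ε * Hζ') - Iζ'|) :=
          add_le_add le_rfl (abs_sub_le _ _ _)
      _ ≤ (1 + ε) * (M * δ₂) + (ε * |Hζ - Hζ'| + (1 + ε) * (M * δ₂)) := by
          rw [hmid]; exact add_le_add hIζ (add_le_add le_rfl h3)
      _ = ε * |Hζ - Hζ'| + 2 * ((1 + ε) * (M * δ₂)) := by ring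
  refine hsplit.trans ?_
  have hδδ : 0 ≤ δ + δ₂ := add_nonneg hδ hδ₂
  calc ε * |Hζ - Hζ'| + 2 * ((1 + ε) * (M * δ₂)) ≤ ε * (M * (δ + δ₂)) + 2 * ((1 + ε) * (M * δ₂)) := by
        refine add_le_add (mul_le_mul_of_nonneg_left (hchain.trans ?_) hε) le_rfl
        exact mul_le_mul_of_nonneg_right hcard hδδ
    _ = ε * M * (δ + δ₂) + 2 * (1 + ε) * M * δ₂ := by ring

end Summit.QuantumFields.YangMills.Theorems.FiniteSizeCriterion

end
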